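import Mathlib
import HarnessLib
import Summits.Ventures.LatticeQCDFlow.Exactness.SphereExpMapChart

/-!
# One geodesic step from a ball-uniform ambient momentum dominates a multiple of the uniform measure of the sphere — from every point, with any bounded momentum shift

HONEST FRAMING: exact (Metropolis-corrected) sampling algorithms for lattice gauge theory;
figures of merit are autocorrelation/cost numbers at stated couplings and volumes; no
continuum-physics claim.

Venture `LatticeQCDFlow` (cell pub-lqcd), topic `Exactness`, FANOUT row 9 (eng-latcore, the
engine `latflow.core.cpn_2d.HMCCPN`, one leapfrog step: the proposed site is
`_geodesic(z, π + ½εF, ε)`).  NEW WORK of the cell over Mathlib (`Measure.restrict_map`,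
`Measure.prod_restrict`, `Measure.map_snd_prod`, `measure_preimage_add_right`,
`LinearIsometryEquiv.measurePreserving`) and the tree: part 2a `SphereExpMapChart.lean`
(`spherePos`, `spherePos_actSO_add`, `spherePos_polarAxisPt`, **`toSphere_le_smul_map_expBall`**),
row 7's `SphereAxisCoordinates.lean` (`axisCoords`, `measurePreserving_axisCoords`,
`norm_sq_axisCoords_symm`), `SphereOrbitLaw.lean` (`exists_actSO_eq` — transitivity,
`uniformSphere_map_actS` — invariance) and `RadialPolar.lean` (`uniformSphere`).  Nothing is cited as a fact.

Part 2b of the gen-16 chain (CP(N−1)/sphere HMC ergodicity): the momentum-side bookkeeping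
around the chart comparison of part 2a — the sphere analogue of gen-13's
`SU2ExpChartMinorisation.smul_haarProbability_le_map_kickDrift`.

## Content (`n : ℕ`, `E = ℝ^{n+2}`, `S = S^{n+1}`, `E' = ℝ^{n+1}` the equatorial coordinates)

* §1 `axisCoords_symm_add`, `axisCoords_snd_add`, `norm_axisCoords_snd_le`,
  `axisCylinder_subset_ball` — the cylinder `{|q₀| < 1, ‖q_eq‖ < a}` sits in the ball of radius `a + 1`;
  `map_restrict_ball_expBall_le_shift` — translating the equatorial ball by `w₂`, `‖w₂‖ ≤ b`, and
  enlarging it to radius `π/t + b` keeps the push-forward through `expBall` above the unshifted one;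
  `map_restrict_axisCylinder` — Lebesgue measure on the cylinder pushed through a function of the
  equatorial coordinates is `2 •` the equatorial push-forward (Fubini along the axis).
* §2 **`smul_toSphere_le_map_spherePos_polarAxisPt`** — AT THE POLE: for `t > 0`, `b ≥ 0`,
  `‖w‖ ≤ b`: `(2 (t^{n+1})⁻¹) • σ_{n+2} ≤ (Lebesgue|_{ball 0 (π/t + b + 1)}).map (q ↦ spherePos t e₀ (q + w))`.
* §3 `map_linearIsometryEquiv_restrict_ball` (Lebesgue on a centred ball is rotation invariant),
  `toSphere_eq_smul_uniformSphere`, `sphereExpConst n t = 2 (t^{n+1})⁻¹ |S^{n+1}|` (`≠ 0`, `≠ ⊤`), and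
  **`smul_uniformSphere_le_map_spherePos`** — FROM EVERY POINT `x ∈ S^{n+1}` and for every shift
  `‖w‖ ≤ b`: `sphereExpConst n t • uniformSphere ≤ (Lebesgue|_{ball 0 (π/t + b + 1)}).map (q ↦ spherePos t x (q + w))`
  (rotate the pole to `x` by `exists_actSO_eq`; the endpoint is equivariant, Lebesgue on the ball
  and the uniform law are invariant).  This is the `hpush` input of
  `LeapfrogHMCDoeblin.refreshUpdate_involMH_minorised` for geodesic leapfrog on spheres.

NOT CLAIMED: any sharp constant; the circle case is NOT special-cased (it is `n = 0` here, equator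
`S⁰ = {±1}`); rates.
-/

noncomputable section

namespace Summit.Ventures.LatticeQCDFlow.Exactness

open MeasureTheory Measure Metric Set Real
open scoped ENNReal InnerProductSpace

variable (n : ℕ)

/-! ## §1 Axis-coordinate bookkeeping -/

/-- The inverse axis coordinates are additive. -/
theorem axisCoords_symm_add (p p' : ℝ × EuclideanSpace ℝ (Fin (n + 1))) :
    (axisCoords n).symm p + (axisCoords n).symm p' = (axisCoords n).symm (p + p') := by
  rw [axisCoords_symm_apply_eq, axisCoords_symm_apply_eq, axisCoords_symm_apply_eq, Prod.fst_add,
    Prod.snd_add, add_smul, map_add]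
  abel

/-- The equatorial coordinates of a sum. -/
theorem axisCoords_snd_add (q w : EuclideanSpace ℝ (Fin (n + 2))) :
    (axisCoords n (q + w)).2 = (axisCoords n q).2 + (axisCoords n w).2 := by
  have h : q + w = (axisCoords n).symm (axisCoords n q + axisCoords n w) := by
    rw [← axisCoords_symm_add, MeasurableEquiv.symm_apply_apply, MeasurableEquiv.symm_apply_apply]
  rw [h, MeasurableEquiv.apply_symm_apply, Prod.snd_add]

/-- Pythagoras along the axis, read from the vector. -/
theorem norm_sq_eq_axisCoords (q : EuclideanSpace ℝ (Fin (n + 2))) :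
    ‖q‖ ^ 2 = (axisCoords n q).1 ^ 2 + ‖(axisCoords n q).2‖ ^ 2 := by
  conv_lhs => rw [← (axisCoords n).symm_apply_apply q]
  exact norm_sq_axisCoords_symm n _ _

/-- The equatorial part is no longer than the vector. -/
theorem norm_axisCoords_snd_le (w : EuclideanSpace ℝ (Fin (n + 2))) : ‖(axisCoords n w).2‖ ≤ ‖w‖ := by
  refine le_of_pow_le_pow_left₀ two_ne_zero (norm_nonneg _) ?_
  rw [norm_sq_eq_axisCoords n w]
  nlinarith [sq_nonneg (axisCoords n w).1]

/-- The axis cylinder `{|q₀| < 1} × {‖q_eq‖ < a}` (in axis coordinates). -/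
def axisCylinder (a : ℝ) : Set (EuclideanSpace ℝ (Fin (n + 2))) :=
  (axisCoords n) ⁻¹' (Ioo (-1 : ℝ) 1 ×ˢ ball (0 : EuclideanSpace ℝ (Fin (n + 1))) a)

/-- The cylinder is measurable. -/
theorem measurableSet_axisCylinder (a : ℝ) : MeasurableSet (axisCylinder n a) :=
  (axisCoords n).measurable (measurableSet_Ioo.prod measurableSet_ball)

/-- **The cylinder sits in the ball of radius `a + 1`.** -/
theorem axisCylinder_subset_ball {a : ℝ} (ha : 0 ≤ a) :
    axisCylinder n a ⊆ ball (0 : EuclideanSpace ℝ (Fin (n + 2))) (a + 1) := by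
  intro q hq
  rw [axisCylinder, mem_preimage, mem_prod, mem_Ioo, mem_ball_zero_iff] at hq
  rw [mem_ball_zero_iff]
  have h1 : (axisCoords n q).1 ^ 2 < 1 := by nlinarith [hq.1.1, hq.1.2]
  have h2 : ‖(axisCoords n q).2‖ ^ 2 ≤ a ^ 2 := pow_le_pow_left₀ (norm_nonneg _) hq.2.le 2
  have h3 : ‖q‖ ^ 2 < (a + 1) ^ 2 := by rw [norm_sq_eq_axisCoords n q]; nlinarith
  exact lt_of_pow_lt_pow_left₀ 2 (by linarith) h3

/-- **Shifting and enlarging the equatorial ball.**  For `r + ‖w₂‖ ≤ a`, Lebesgue measure on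
`ball 0 r` pushed through `expBall n t` is dominated by Lebesgue measure on `ball 0 a` pushed
through `y ↦ expBall n t (y + w₂)` (translation invariance; `ball 0 r ⊆ ball w₂ a`). -/
theorem map_restrict_ball_expBall_le_shift (t : ℝ) {r a : ℝ} (w₂ : EuclideanSpace ℝ (Fin (n + 1)))
    (hr : r + ‖w₂‖ ≤ a) :
    ((volume : Measure (EuclideanSpace ℝ (Fin (n + 1)))).restrict (ball 0 r)).map (expBall n t) ≤
      ((volume : Measure (EuclideanSpace ℝ (Fin (n + 1)))).restrict (ball 0 a)).map
        fun y => expBall n t (y + w₂) := by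
  have hmeas : Measurable fun y : EuclideanSpace ℝ (Fin (n + 1)) => expBall n t (y + w₂) :=
    (measurable_expBall n t).comp (measurable_add_const w₂)
  refine Measure.le_iff.2 fun A hA => ?_
  rw [Measure.map_apply (measurable_expBall n t) hA, Measure.map_apply hmeas hA,
    Measure.restrict_apply (measurable_expBall n t hA), Measure.restrict_apply (hmeas hA)]
  have hset : (fun y : EuclideanSpace ℝ (Fin (n + 1)) => expBall n t (y + w₂)) ⁻¹' A ∩ ball 0 a =
      (fun y => y + w₂) ⁻¹' (expBall n t ⁻¹' A ∩ ball w₂ a) := by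
    ext y
    simp [mem_ball, dist_eq_norm]
  rw [hset, measure_preimage_add_right]
  refine measure_mono (Set.inter_subset_inter_right _ (ball_subset_ball' ?_))
  rwa [dist_comm, dist_zero_right]

/-- **Fubini along the axis.**  Lebesgue measure on the cylinder, pushed through a map that factors
through the equatorial coordinates, is `2 •` the push-forward of equatorial Lebesgue measure on the
equatorial ball (`2 = |(-1, 1)|`). -/
theorem map_restrict_axisCylinder {X : Type*} [MeasurableSpace X] (a : ℝ)
    {g : EuclideanSpace ℝ (Fin (n + 1)) → X} (hg : Measurable g)
    {f : EuclideanSpace ℝ (Fin (n + 2)) → X} (hf : Measurable f)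
    (hfg : ∀ q, f q = g (axisCoords n q).2) :
    ((volume : Measure (EuclideanSpace ℝ (Fin (n + 2)))).restrict (axisCylinder n a)).map f =
      (2 : ℝ≥0∞) • ((volume : Measure (EuclideanSpace ℝ (Fin (n + 1)))).restrict (ball 0 a)).map g := by
  have hvol : (volume : Measure (EuclideanSpace ℝ (Fin (n + 2)))) =
      ((volume : Measure ℝ).prod (volume : Measure (EuclideanSpace ℝ (Fin (n + 1))))).map
        (axisCoords n).symm :=
    ((measurePreserving_axisCoords n).symm _).map_eq.symm
  have hfs : f ∘ (axisCoords n).symm = g ∘ Prod.snd := by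
    funext p
    rw [Function.comp_apply, hfg, MeasurableEquiv.apply_symm_apply, Function.comp_apply]
  have hpre : (axisCoords n).symm ⁻¹' axisCylinder n a =
      Ioo (-1 : ℝ) 1 ×ˢ ball (0 : EuclideanSpace ℝ (Fin (n + 1))) a :=
    MeasurableEquiv.symm_preimage_preimage _ _
  rw [hvol, Measure.restrict_map (axisCoords n).symm.measurable (measurableSet_axisCylinder n a),
    Measure.map_map hf (axisCoords n).symm.measurable, hfs, hpre, ← Measure.prod_restrict,
    ← Measure.map_map hg measurable_snd, Measure.map_snd_prod, Measure.map_smul,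
    Measure.restrict_apply_univ, Real.volume_Ioo]
  norm_num

/-! ## §2 At the pole -/

/-- **AT THE POLE: one geodesic step from a ball-uniform ambient momentum, shifted by any `w` with
`‖w‖ ≤ b`, dominates `2 (t^{n+1})⁻¹ •` the surface measure.**  (The step depends on the momentum only
through its equatorial part; restrict Lebesgue measure to the cylinder `{|q₀|<1} × {‖q_eq‖ < π/t + b}`
inside the ball, integrate out the axis coordinate, undo the shift, and apply part 2a.) -/
theorem smul_toSphere_le_map_spherePos_polarAxisPt {t b : ℝ} (ht : 0 < t) (hb : 0 ≤ b)
    {w : EuclideanSpace ℝ (Fin (n + 2))} (hw : ‖w‖ ≤ b) :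
    (2 * (ENNReal.ofReal (t ^ (n + 1)))⁻¹) • (volume : Measure (EuclideanSpace ℝ (Fin (n + 2)))).toSphere ≤
      ((volume : Measure (EuclideanSpace ℝ (Fin (n + 2)))).restrict (ball 0 (π / t + b + 1))).map
        fun q => spherePos t (polarAxisPt n) (q + w) := by
  set a : ℝ := π / t + b with ha_def
  set w₂ : EuclideanSpace ℝ (Fin (n + 1)) := (axisCoords n w).2 with hw₂
  have ha : 0 ≤ a := by positivity
  have hf : Measurable fun q : EuclideanSpace ℝ (Fin (n + 2)) => spherePos t (polarAxisPt n) (q + w) :=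
    (measurable_spherePos_right t (polarAxisPt n)).comp (measurable_add_const w)
  have hg : Measurable fun y : EuclideanSpace ℝ (Fin (n + 1)) => expBall n t (y + w₂) :=
    (measurable_expBall n t).comp (measurable_add_const w₂)
  have hfg : ∀ q, spherePos t (polarAxisPt n) (q + w) = expBall n t ((axisCoords n q).2 + w₂) := by
    intro q
    rw [spherePos_polarAxisPt, axisCoords_snd_add]
  -- the chart comparison (part 2a), inverted constant
  have hc0 : ENNReal.ofReal (t ^ (n + 1)) ≠ 0 := (ENNReal.ofReal_pos.2 (by positivity)).ne'
  have hchart : (ENNReal.ofReal (t ^ (n + 1)))⁻¹ • (volume : Measure (EuclideanSpace ℝ (Fin (n + 2)))).toSphere ≤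
      ((volume : Measure (EuclideanSpace ℝ (Fin (n + 1)))).restrict (ball 0 (π / t))).map (expBall n t) := by
    refine Measure.le_iff'.2 fun A => ?_
    have h := Measure.le_iff'.1 (toSphere_le_smul_map_expBall n ht) A
    rw [Measure.smul_apply, smul_eq_mul] at h ⊢
    calc (ENNReal.ofReal (t ^ (n + 1)))⁻¹ * (volume : Measure (EuclideanSpace ℝ (Fin (n + 2)))).toSphere A
        ≤ (ENNReal.ofReal (t ^ (n + 1)))⁻¹ * (ENNReal.ofReal (t ^ (n + 1)) *
            ((volume : Measure (EuclideanSpace ℝ (Fin (n + 1)))).restrict (ball 0 (π / t))).map (expBall n t) A) :=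
          mul_le_mul' le_rfl h
      _ = ((volume : Measure (EuclideanSpace ℝ (Fin (n + 1)))).restrict (ball 0 (π / t))).map (expBall n t) A := by
          rw [← mul_assoc, ENNReal.inv_mul_cancel hc0 ENNReal.ofReal_ne_top, one_mul]
  -- the shift
  have hshift := map_restrict_ball_expBall_le_shift n t w₂ (r := π / t) (a := a)
    (by rw [ha_def]; linarith [norm_axisCoords_snd_le n w])
  -- assemble
  calc (2 * (ENNReal.ofReal (t ^ (n + 1)))⁻¹) • (volume : Measure (EuclideanSpace ℝ (Fin (n + 2)))).toSphere
      = (2 : ℝ≥0∞) • ((ENNReal.ofReal (t ^ (n + 1)))⁻¹ •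
          (volume : Measure (EuclideanSpace ℝ (Fin (n + 2)))).toSphere) := by rw [smul_smul]
    _ ≤ (2 : ℝ≥0∞) • ((volume : Measure (EuclideanSpace ℝ (Fin (n + 1)))).restrict (ball 0 a)).map
          fun y => expBall n t (y + w₂) :=
        Measure.le_iff'.2 fun A => by
          simpa only [Measure.smul_apply, smul_eq_mul] using
            mul_le_mul' le_rfl (Measure.le_iff'.1 (hchart.trans hshift) A)
    _ = ((volume : Measure (EuclideanSpace ℝ (Fin (n + 2)))).restrict (axisCylinder n a)).map
          fun q => spherePos t (polarAxisPt n) (q + w) :=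
        (map_restrict_axisCylinder n a hg hf hfg).symm
    _ ≤ ((volume : Measure (EuclideanSpace ℝ (Fin (n + 2)))).restrict (ball 0 (π / t + b + 1))).map
          fun q => spherePos t (polarAxisPt n) (q + w) :=
        Measure.map_mono (Measure.restrict_mono_set _ (axisCylinder_subset_ball n ha)) hf

/-! ## §3 From every point, by rotation -/

/-- **Lebesgue measure on a centred ball is invariant under every linear isometry.** -/
theorem map_linearIsometryEquiv_restrict_ball {m : Type*} [Fintype m]
    (L : EuclideanSpace ℝ m ≃ₗᵢ[ℝ] EuclideanSpace ℝ m) (R : ℝ) :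
    ((volume : Measure (EuclideanSpace ℝ m)).restrict (ball 0 R)).map L =
      (volume : Measure (EuclideanSpace ℝ m)).restrict (ball 0 R) := by
  have hpre : L ⁻¹' ball (0 : EuclideanSpace ℝ m) R = ball 0 R := by
    ext q; simp
  calc ((volume : Measure (EuclideanSpace ℝ m)).restrict (ball 0 R)).map L
      = ((volume : Measure (EuclideanSpace ℝ m)).restrict (L ⁻¹' ball 0 R)).map L := by rw [hpre]
    _ = ((volume : Measure (EuclideanSpace ℝ m)).map L).restrict (ball 0 R) :=
        (Measure.restrict_map L.continuous.measurable measurableSet_ball).symm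
    _ = (volume : Measure (EuclideanSpace ℝ m)).restrict (ball 0 R) := by rw [L.measurePreserving.map_eq]

/-- The surface measure is its total mass times the uniform probability. -/
theorem toSphere_eq_smul_uniformSphere :
    (volume : Measure (EuclideanSpace ℝ (Fin (n + 2)))).toSphere =
      (volume : Measure (EuclideanSpace ℝ (Fin (n + 2)))).toSphere univ •
        uniformSphere (volume : Measure (EuclideanSpace ℝ (Fin (n + 2)))) := by
  rw [uniformSphere, smul_smul, ENNReal.mul_inv_cancel (toSphere_univ_ne_zero _) (measure_ne_top _ _),
    one_smul]

/-- **The minorisation constant** `2 (t^{n+1})⁻¹ |S^{n+1}|`. -/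
def sphereExpConst (t : ℝ) : ℝ≥0∞ :=
  2 * (ENNReal.ofReal (t ^ (n + 1)))⁻¹ * (volume : Measure (EuclideanSpace ℝ (Fin (n + 2)))).toSphere univ

/-- The constant is not zero. -/
theorem sphereExpConst_ne_zero (t : ℝ) : sphereExpConst n t ≠ 0 := by
  unfold sphereExpConst
  exact mul_ne_zero (mul_ne_zero two_ne_zero (ENNReal.inv_ne_zero.2 ENNReal.ofReal_ne_top))
    (toSphere_univ_ne_zero _)

/-- The constant is finite (`t > 0`). -/
theorem sphereExpConst_ne_top {t : ℝ} (ht : 0 < t) : sphereExpConst n t ≠ ⊤ := by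
  unfold sphereExpConst
  refine ENNReal.mul_ne_top (ENNReal.mul_ne_top ENNReal.ofNat_ne_top ?_) (measure_ne_top _ _)
  exact ENNReal.inv_ne_top.2 (ENNReal.ofReal_pos.2 (by positivity)).ne'

/-- **ONE GEODESIC STEP FROM A BALL-UNIFORM AMBIENT MOMENTUM DOMINATES A MULTIPLE OF THE UNIFORM
MEASURE OF THE SPHERE, FROM EVERY POINT AND WITH ANY BOUNDED SHIFT.**  For `t > 0`, `b ≥ 0`, every
`x ∈ S^{n+1}` and every `w ∈ ℝ^{n+2}` with `‖w‖ ≤ b`: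
`sphereExpConst n t • uniformSphere ≤ (Lebesgue|_{ball 0 (π/t + b + 1)}).map (q ↦ spherePos t x (q + w))`.
(Rotate the pole to `x`: `SO(n+2)` is transitive on the sphere, the geodesic endpoint is
equivariant, Lebesgue measure on the ball and the uniform law are invariant.) -/
theorem smul_uniformSphere_le_map_spherePos {t b : ℝ} (ht : 0 < t) (hb : 0 ≤ b)
    (x : sphere (0 : EuclideanSpace ℝ (Fin (n + 2))) 1) {w : EuclideanSpace ℝ (Fin (n + 2))} (hw : ‖w‖ ≤ b) :
    sphereExpConst n t • uniformSphere (volume : Measure (EuclideanSpace ℝ (Fin (n + 2)))) ≤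
      ((volume : Measure (EuclideanSpace ℝ (Fin (n + 2)))).restrict (ball 0 (π / t + b + 1))).map
        fun q => spherePos t x (q + w) := by
  obtain ⟨O, rfl⟩ := exists_actSO_eq (by rw [Fintype.card_fin]; omega) (polarAxisPt n) x
  set ν := (volume : Measure (EuclideanSpace ℝ (Fin (n + 2)))).restrict (ball 0 (π / t + b + 1)) with hν
  set w' : EuclideanSpace ℝ (Fin (n + 2)) := (rotSO O).symm w with hw'
  have hw'b : ‖w'‖ ≤ b := by rwa [hw', LinearIsometryEquiv.norm_map]
  have hg : Measurable fun q : EuclideanSpace ℝ (Fin (n + 2)) => spherePos t (polarAxisPt n) (q + w') :=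
    (measurable_spherePos_right t (polarAxisPt n)).comp (measurable_add_const w')
  have hA : Measurable (actSO O : sphere (0 : EuclideanSpace ℝ (Fin (n + 2))) 1 →
      sphere (0 : EuclideanSpace ℝ (Fin (n + 2))) 1) := measurable_actSO_right O
  -- the step from `O e₀` is the rotated step from `e₀` with the rotated-back momentum
  have hfun : (fun q : EuclideanSpace ℝ (Fin (n + 2)) => spherePos t (actSO O (polarAxisPt n)) (q + w)) =
      (actSO O ∘ fun q => spherePos t (polarAxisPt n) (q + w')) ∘ (rotSO O).symm := by
    funext q
    rw [Function.comp_apply, Function.comp_apply, hw', ← spherePos_actSO_add,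
      LinearIsometryEquiv.apply_symm_apply]
  have hνsymm : ν.map (rotSO O).symm = ν := map_linearIsometryEquiv_restrict_ball (rotSO O).symm _
  rw [hfun, ← Measure.map_map (hA.comp hg) (rotSO O).symm.continuous.measurable, hνsymm,
    ← Measure.map_map hA hg]
  -- the pole estimate, rotated
  have hpole := smul_toSphere_le_map_spherePos_polarAxisPt n ht hb hw'b
  have hσ : (actSO O : sphere (0 : EuclideanSpace ℝ (Fin (n + 2))) 1 → sphere (0 : EuclideanSpace ℝ (Fin (n + 2))) 1) =
      actS (O : Matrix (Fin (n + 2)) (Fin (n + 2)) ℝ) (mem_orthogonalGroup_of_SO O) := rfl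
  calc sphereExpConst n t • uniformSphere (volume : Measure (EuclideanSpace ℝ (Fin (n + 2))))
      = ((2 * (ENNReal.ofReal (t ^ (n + 1)))⁻¹) • (volume : Measure (EuclideanSpace ℝ (Fin (n + 2)))).toSphere).map
          (actSO O) := by
        rw [Measure.map_smul, toSphere_eq_smul_uniformSphere n, Measure.map_smul, hσ,
          uniformSphere_map_actS, smul_smul, sphereExpConst]
    _ ≤ (ν.map fun q => spherePos t (polarAxisPt n) (q + w')).map (actSO O) :=
        Measure.map_mono hpole hA

end Summit.Ventures.LatticeQCDFlow.Exactness

end
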